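import Literature.NumberTheory.LFunctions.WeilExplicit
import Literature.NumberTheory.LFunctions.WeilExplicitProofs
import Literature.NumberTheory.LFunctions.WeilExplicitFormulaProofs
import Literature.NumberTheory.LFunctions.WeilArchimedeanPositivityProofs
import Summits.RiemannHypothesis.RiemannHypothesis.Theorems.RuelleBandCofiniteCriticalLineStubBranchesContinuousAux

/-!
# The known envelope of the sign-cone cruxes — core estimate (route `SignCone`, item stmt-RiemannHypothesis-16302)

Literature-vocabulary core of the envelope `RH ⇒ SignConeOscillatory` (the route-decl corollaries live in
`SignConeSignConeOscillatoryEnvelope.lean`, which imports the route file). For a finite family of Weil test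
functions `gᵢ` with autocorrelation sum `F = Σᵢ gᵢ ⋆ g̃ᵢ` that is non-negative at the nodes `log n` (`n ≥ 2`):

* `W_ar(F) := weilPolarTerm F + weilArchTerm F = W(F) + P_Λ(F)` (definition of `weilFunctional`);
* `W(F) = Σᵢ Q(gᵢ)` (additivity of `W` on test kernels, `stub_branchesContinuous_weilFunctional_sum`);
* `Re P_Λ(F) = Σₙ Λ(n) n^{-1/2} · 2 Re F(log n) ≥ 0` on the sign cone (`re_weilPrimeTerm_nonneg`, hermitian
  symmetry `F(-t) = conj F(t)` of autocorrelation kernels);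
* `F(0) = Σᵢ ‖gᵢ‖₂² ≥ 0`;

hence `-Re F(0) ≤ Re W_ar(F)` as soon as every `Re Q(gᵢ) ≥ 0` (`neg_re_apply_zero_le_re_weilArchPolar`), in
particular under `WeilPositivity` and under `RiemannHypothesis`
(`WeilPositivity.of_riemannHypothesis explicit_formula_holds`). Support lemmas; they do not close the item.
-/

noncomputable section

-- `Summit.RiemannHypothesis.RiemannHypothesis.…` repeats a namespace component by design (D-0017 layout).
set_option linter.dupNamespace false

open scoped BigOperators ComplexConjugate ArithmeticFunction.vonMangoldt
open Complex MeasureTheory Set Filter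

namespace Summit.RiemannHypothesis.RiemannHypothesis.Theorems.SignCone

open Literature.NumberTheory.LFunctions
open Summit.RiemannHypothesis.RiemannHypothesis.Theorems.RuelleBandCofiniteCriticalLine

/-! ## Finite sums of test kernels

`W(0) = 0`, "finite sums of Weil tests are Weil tests" and the additivity `W(Σ Gᵢ) = Σ W(Gᵢ)` are already
landed (`RuelleBandCofiniteCriticalLineStubBranchesContinuousAux.lean`) and are reused from there. -/

/-! ## The prime term on the sign cone -/

/-- On a hermitian kernel (`conj F(-t) = F(t)`) that is non-negative at the nodes (`Re F(log n) ≥ 0`,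
`n ≥ 2`) the prime term `P_Λ(F) = Σₙ Λ(n) n^{-1/2} (F(log n) + F(-log n))` has non-negative real part:
each summand has real part `Λ(n) n^{-1/2} · 2 Re F(log n)`, and `Λ(0) = Λ(1) = 0`. [folklore] -/
theorem re_weilPrimeTerm_nonneg {F : ℝ → ℂ} (hFc : HasCompactSupport F)
    (hsym : ∀ t : ℝ, conj (F (-t)) = F t) (hn : ∀ n : ℕ, 2 ≤ n → 0 ≤ (F (Real.log n)).re) :
    0 ≤ (weilPrimeTerm F).re := by
  unfold weilPrimeTerm
  rw [Complex.re_tsum (summable_weilPrimeTerm hFc)]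
  refine tsum_nonneg fun n => ?_
  have hcoef : ((Λ n : ℝ) : ℂ) / (Real.sqrt n : ℂ) = ((Λ n / Real.sqrt n : ℝ) : ℂ) := by
    push_cast
    rfl
  rcases lt_or_ge n 2 with hn2 | hn2
  · have hΛ : Λ n = 0 := by
      interval_cases n <;> simp
    simp [hΛ]
  · have hre' : (F (-Real.log n)).re = (F (Real.log n)).re := by
      have h := congrArg Complex.re (hsym (Real.log n))
      simpa only [Complex.conj_re] using h
    have hre : (F (Real.log n) + F (-Real.log n)).re = 2 * (F (Real.log n)).re := by
      rw [Complex.add_re, hre']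
      ring
    rw [hcoef, Complex.re_ofReal_mul, hre]
    exact mul_nonneg (div_nonneg ArithmeticFunction.vonMangoldt_nonneg (Real.sqrt_nonneg _))
      (by nlinarith [hn n hn2])

/-! ## The core estimate -/

/-- **Core of the envelope.** Let `F = Σᵢ gᵢ ⋆ g̃ᵢ` be a finite sum of autocorrelations of Weil test
functions, non-negative at the nodes `log n` (`n ≥ 2`), and suppose every summand has `Re Q(gᵢ) ≥ 0`
(`Q = weilQuadratic`). Then `-Re F(0) ≤ Re (weilPolarTerm F + weilArchTerm F)`; in fact
`Re W_ar(F) = Σᵢ Re Q(gᵢ) + Re P_Λ(F) ≥ 0` and `F(0) = Σᵢ ‖gᵢ‖₂² ≥ 0`. [folklore] -/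
theorem neg_re_apply_zero_le_re_weilArchPolar {k : ℕ} {g : Fin k → ℝ → ℂ} {F : ℝ → ℂ}
    (hF : F = fun t => ∑ i, weilConv (g i) (weilReflect (g i)) t)
    (hg : ∀ i, IsWeilTest (g i)) (hQ : ∀ i, 0 ≤ (weilQuadratic (g i)).re)
    (hn : ∀ n : ℕ, 2 ≤ n → 0 ≤ (F (Real.log n)).re) :
    -(F 0).re ≤ (weilPolarTerm F + weilArchTerm F).re := by
  have hGi : ∀ i, IsWeilTest (weilConv (g i) (weilReflect (g i))) := fun i =>
    (hg i).weilConv (hg i).weilReflect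
  have hFt : IsWeilTest F := by
    rw [hF]
    exact stub_branchesContinuous_isWeilTest_sum _ fun i _ => hGi i
  have hdec : weilPolarTerm F + weilArchTerm F = weilFunctional F + weilPrimeTerm F := by
    unfold weilFunctional
    ring
  have hW : weilFunctional F = ∑ i, weilQuadratic (g i) := by
    rw [hF, stub_branchesContinuous_weilFunctional_sum _ fun i _ => hGi i]
    rfl
  have hWre : 0 ≤ (weilFunctional F).re := by
    rw [hW, Complex.re_sum]
    exact Finset.sum_nonneg fun i _ => hQ i
  have hsym : ∀ t : ℝ, conj (F (-t)) = F t := by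
    intro t
    simp only [hF, map_sum, conj_weilConv_weilReflect_neg]
  have hPre : 0 ≤ (weilPrimeTerm F).re := re_weilPrimeTerm_nonneg hFt.2 hsym hn
  have h0 : 0 ≤ (F 0).re := by
    rw [hF]
    simp only [Complex.re_sum, weilConv_weilReflect_apply_zero, Complex.ofReal_re]
    exact Finset.sum_nonneg fun i _ => integral_nonneg fun t => by positivity
  rw [hdec, Complex.add_re]
  linarith

/-- The core estimate under Weil positivity: every `Re Q(gᵢ) ≥ 0`. [folklore] -/
theorem neg_re_apply_zero_le_re_weilArchPolar_of_weilPositivity (hWP : WeilPositivity) {k : ℕ}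
    {g : Fin k → ℝ → ℂ} {F : ℝ → ℂ} (hF : F = fun t => ∑ i, weilConv (g i) (weilReflect (g i)) t)
    (hg : ∀ i, IsWeilTest (g i)) (hn : ∀ n : ℕ, 2 ≤ n → 0 ≤ (F (Real.log n)).re) :
    -(F 0).re ≤ (weilPolarTerm F + weilArchTerm F).re :=
  neg_re_apply_zero_le_re_weilArchPolar hF hg (fun i => hWP _ (hg i)) hn

/-- The core estimate under the Riemann hypothesis (unconditional implication: the explicit formula
`explicit_formula_holds` and the easy half of Weil's criterion `WeilPositivity.of_riemannHypothesis` are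
theorems of the tree). [folklore] -/
theorem neg_re_apply_zero_le_re_weilArchPolar_of_riemannHypothesis (hRH : RiemannHypothesis) {k : ℕ}
    {g : Fin k → ℝ → ℂ} {F : ℝ → ℂ} (hF : F = fun t => ∑ i, weilConv (g i) (weilReflect (g i)) t)
    (hg : ∀ i, IsWeilTest (g i)) (hn : ∀ n : ℕ, 2 ≤ n → 0 ≤ (F (Real.log n)).re) :
    -(F 0).re ≤ (weilPolarTerm F + weilArchTerm F).re :=
  neg_re_apply_zero_le_re_weilArchPolar_of_weilPositivity
    (WeilPositivity.of_riemannHypothesis explicit_formula_holds hRH) hF hg hn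

end Summit.RiemannHypothesis.RiemannHypothesis.Theorems.SignCone

end
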